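import Mathlib
import HarnessLib
import Summits.AtomisticToContinuum.Crystallization.Theorems.HolmgrenBoyleLindHalfSpaceUniqueContinuationThickColumnRigidity
import Summits.AtomisticToContinuum.Crystallization.Theorems.HolmgrenBoyleLindHalfSpaceUniqueContinuationUpperDensityBlaschke
import Summits.AtomisticToContinuum.Crystallization.Theorems.HolmgrenBoyleLindHalfSpaceUniqueContinuationDenseColumn

/-!
# Route `HolmgrenBoyleLind`: Lennard-Jones force fields of separated sources, part 21c —
COMMENSURATE LAYERED PAIRS over a generic layer lattice are rigid

Support file for the crux item stmt-AtomisticToContinuum-6075 (`HalfSpaceUniqueContinuation`, line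
`registered`, layered core; written by lead c3).

* **`hbl_layered_eq_of_finite_registries'`** (+ registered `∀`-form
  `hbl_layered_eq_of_finite_registries`) — in the setting of the registered stub
  `stub_layeredOpenVanishing` (two `δ`-separated balanced sets with common independent horizontal
  periods `s, t ⊥ u`, agreeing below a horizontal plane, `ω` moreover `r`-dense), if the layer
  lattice is GENERIC and the registries of `ω` fall into FINITELY MANY classes modulo `ℤs + ℤt`
  (every `x ∈ ω` is `b + m₁ s + m₂ t + τ u` with `b` from a finite set), then `ω = ω'`: a registry
  class of positive upper density (part 21b, `hbl_exists_dense_column'`) is a thick column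
  (part 21a, `hbl_not_summable_inv_of_upperDensity'`), and thick-column rigidity (part 20c,
  `hbl_thickColumn_rigidity'`) applies. This is the COMMENSURATE half of the layered stub for
  generic layer lattices; the incommensurate half with a periodic sub-structure is interface
  rigidity (part 17c).
All `[folklore]`; nothing here closes an item.
-/

noncomputable section

namespace Summit.AtomisticToContinuum.Crystallization.Theorems.HolmgrenBoyleLind

open scoped BigOperators Topology InnerProductSpace RealInnerProductSpace
open MeasureTheory Filter Set Literature.Algebra.EuclideanLattices.LatticePeriodic
open scoped Classical

/-! ## Layered pairs with finitely many registry classes -/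

/-- **COMMENSURATE LAYERED PAIRS ARE RIGID (generic layer lattice).** Let `ω, ω' ⊂ ℝ³` be
`δ`-separated and in exact Lennard-Jones force balance, with two common independent horizontal
periods `s, t ⊥ u` spanning a GENERIC layer lattice, agreeing on the open half-space
`{⟪z, u⟫ < a}`; let `ω` be `r`-dense with FINITELY MANY REGISTRY CLASSES: every `x ∈ ω` is
`b + m₁ s + m₂ t + τ u` with `b` in a finite set `S`, `m₁, m₂ ∈ ℤ`, `τ ∈ ℝ` (e.g. every
`s,t`-periodic FLC configuration whose registry walk has only rational steps, after refining the
lattice). Then `ω = ω'`: a registry class of positive upper density gives a thick column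
(`hbl_exists_dense_column'`, `hbl_not_summable_inv_of_upperDensity'`) and
`hbl_thickColumn_rigidity'` applies. [folklore] -/
theorem hbl_layered_eq_of_finite_registries' {ω ω' : Set (EuclideanSpace ℝ (Fin 3))} {δ r : ℝ}
    (hδ : 0 < δ) (hr : 0 < r)
    (hsep : ∀ x ∈ ω, ∀ y ∈ ω, x ≠ y → δ ≤ dist x y)
    (hsep' : ∀ x ∈ ω', ∀ y ∈ ω', x ≠ y → δ ≤ dist x y)
    (hdense : ∀ c : EuclideanSpace ℝ (Fin 3), ∃ y ∈ ω, dist y c ≤ r)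
    (hbal : ∀ x ∈ ω, HasSum (fun y : {y : EuclideanSpace ℝ (Fin 3) // y ∈ ω ∧ y ≠ x} =>
      (deriv Literature.MathematicalPhysics.StatisticalMechanics.lennardJones (dist x y) / dist x y) •
        (x - (y : EuclideanSpace ℝ (Fin 3)))) 0)
    (hbal' : ∀ x ∈ ω', HasSum (fun y : {y : EuclideanSpace ℝ (Fin 3) // y ∈ ω' ∧ y ≠ x} =>
      (deriv Literature.MathematicalPhysics.StatisticalMechanics.lennardJones (dist x y) / dist x y) •
        (x - (y : EuclideanSpace ℝ (Fin 3)))) 0)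
    {s t u : EuclideanSpace ℝ (Fin 3)} {a : ℝ} (hu : ‖u‖ = 1) (ht0 : t ≠ 0)
    (hst : s ∉ Submodule.span ℝ ({t} : Set (EuclideanSpace ℝ (Fin 3))))
    (hsu : ⟪s, u⟫ = 0) (htu : ⟪t, u⟫ = 0)
    (hωt : ∀ x : EuclideanSpace ℝ (Fin 3), x + t ∈ ω ↔ x ∈ ω)
    (hωs : ∀ x : EuclideanSpace ℝ (Fin 3), x + s ∈ ω ↔ x ∈ ω)
    (hω't : ∀ x : EuclideanSpace ℝ (Fin 3), x + t ∈ ω' ↔ x ∈ ω')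
    (hω's : ∀ x : EuclideanSpace ℝ (Fin 3), x + s ∈ ω' ↔ x ∈ ω')
    (hagree : ∀ z : EuclideanSpace ℝ (Fin 3), ⟪z, u⟫ < a → (z ∈ ω ↔ z ∈ ω'))
    (hgen : ∀ w w' : EuclideanSpace ℝ (Fin 3), ⟪w, u⟫ = 0 → ⟪w', u⟫ = 0 →
      (∃ m : ℤ, ⟪w, s⟫ = m) → (∃ m : ℤ, ⟪w, t⟫ = m) →
      (∃ m : ℤ, ⟪w', s⟫ = m) → (∃ m : ℤ, ⟪w', t⟫ = m) → ‖w'‖ = ‖w‖ → w' = w ∨ w' = -w)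
    (S : Finset (EuclideanSpace ℝ (Fin 3)))
    (hS : ∀ x ∈ ω, ∃ b ∈ S, ∃ m₁ m₂ : ℤ, ∃ τ : ℝ,
      x = b + (m₁ : ℝ) • s + (m₂ : ℝ) • t + τ • u) :
    ω = ω' := by
  classical
  -- the plane and its lattice of common periods
  have hu0 : u ≠ 0 := by
    intro h0; rw [h0, norm_zero] at hu; exact zero_ne_one hu
  have hV : Module.finrank ℝ (ℝ ∙ u)ᗮ = 2 := hbl_finrank_orthogonal_span_singleton hu0
  have hsW : s ∈ (ℝ ∙ u)ᗮ := by
    rw [Submodule.mem_orthogonal_singleton_iff_inner_right, real_inner_comm]; exact hsu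
  have htW : t ∈ (ℝ ∙ u)ᗮ := by
    rw [Submodule.mem_orthogonal_singleton_iff_inner_right, real_inner_comm]; exact htu
  set sW : (ℝ ∙ u)ᗮ := ⟨s, hsW⟩ with hsWdef
  set tW : (ℝ ∙ u)ᗮ := ⟨t, htW⟩ with htWdef
  have hli : LinearIndependent ℝ ![tW, sW] := by
    rw [LinearIndependent.pair_iff]
    intro c d hcd
    have hcd' : c • t + d • s = 0 := by
      have := congrArg (fun x : (ℝ ∙ u)ᗮ => (x : EuclideanSpace ℝ (Fin 3))) hcd
      simpa [hsWdef, htWdef] using this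
    by_cases hd : d = 0
    · refine ⟨?_, hd⟩
      rw [hd, zero_smul, add_zero] at hcd'
      exact (smul_eq_zero.1 hcd').resolve_right ht0
    · exfalso
      apply hst
      have hs_eq : s = (-(c / d)) • t := by
        have : d • s = -(c • t) := eq_neg_of_add_eq_zero_right hcd'
        calc s = d⁻¹ • (d • s) := by rw [smul_smul, inv_mul_cancel₀ hd, one_smul]
          _ = (-(c / d)) • t := by rw [this, smul_neg, smul_smul, neg_smul]; ring_nf
      rw [hs_eq]
      exact Submodule.smul_mem _ _ (Submodule.mem_span_singleton_self t)
  set bW : Module.Basis (Fin 2) ℝ (ℝ ∙ u)ᗮ :=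
    basisOfLinearIndependentOfCardEqFinrank hli (by rw [hV]; simp) with hbW
  set Λ : Submodule ℤ (ℝ ∙ u)ᗮ := Submodule.span ℤ (Set.range bW) with hΛ
  have hbW0 : bW 0 = tW := by rw [hbW, coe_basisOfLinearIndependentOfCardEqFinrank]; rfl
  have hbW1 : bW 1 = sW := by rw [hbW, coe_basisOfLinearIndependentOfCardEqFinrank]; rfl
  have htΛ : tW ∈ Λ := hbW0 ▸ Submodule.subset_span ⟨0, rfl⟩
  have hsΛ : sW ∈ Λ := hbW1 ▸ Submodule.subset_span ⟨1, rfl⟩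
  -- invariance of `ω, ω'` under `Λ`
  have hinvgen : ∀ (S : Set (EuclideanSpace ℝ (Fin 3))),
      (∀ x : EuclideanSpace ℝ (Fin 3), x + t ∈ S ↔ x ∈ S) →
      (∀ x : EuclideanSpace ℝ (Fin 3), x + s ∈ S ↔ x ∈ S) →
      ∀ ℓ : Λ, ∀ y : EuclideanSpace ℝ (Fin 3),
        y + ((ℓ : (ℝ ∙ u)ᗮ) : EuclideanSpace ℝ (Fin 3)) ∈ S ↔ y ∈ S := by
    intro S hSt hSs ℓ
    refine hbl_invariant_of_span bW (S := S) (fun i => ?_) ℓ.2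
    fin_cases i
    · simpa [hbW0, htWdef] using hSt
    · simpa [hbW1, hsWdef] using hSs
  have hωΛ := hinvgen ω hωt hωs
  have hω'Λ := hinvgen ω' hω't hω's
  -- the registry classes as a finite subset of the plane
  set P := (ℝ ∙ u)ᗮ.orthogonalProjectionOnto with hPdef
  set S' : Finset (ℝ ∙ u)ᗮ := S.image (fun b => P b) with hS'def
  have hPu : P u = 0 := Submodule.orthogonalProjectionOnto_orthogonalComplement_singleton_eq_zero u
  have hPs : P s = sW := by
    rw [hPdef]; exact Submodule.orthogonalProjectionOnto_mem_subspace_eq_self sW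
  have hPt : P t = tW := by
    rw [hPdef]; exact Submodule.orthogonalProjectionOnto_mem_subspace_eq_self tW
  have hS' : ∀ x ∈ ω, ∃ b ∈ S', ∃ ℓ : Λ, P x = b + (ℓ : (ℝ ∙ u)ᗮ) := by
    intro x hx
    obtain ⟨b, hb, m₁, m₂, τ, hxe⟩ := hS x hx
    refine ⟨P b, Finset.mem_image_of_mem _ hb,
      ⟨(m₁ : ℤ) • sW + (m₂ : ℤ) • tW, Λ.add_mem (Λ.smul_mem _ hsΛ) (Λ.smul_mem _ htΛ)⟩, ?_⟩
    rw [hxe, map_add, map_add, map_add, map_smul, map_smul, map_smul, hPs, hPt, hPu, smul_zero,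
      add_zero, add_assoc]
    congr 1
    rw [Int.cast_smul_eq_zsmul ℝ, Int.cast_smul_eq_zsmul ℝ]
  -- a dense column from the finitely many registry classes
  obtain ⟨b₀, -, tn, d, hd, htn, hsept, hdens, hcol⟩ :=
    hbl_exists_dense_column' hu Λ hδ hr hsep hdense hωΛ S' hS' a
  have hns : ¬ Summable (fun n => (tn n)⁻¹) :=
    hbl_not_summable_inv_of_upperDensity' hδ hd htn hsept hdens
  have hinj : Function.Injective tn := by
    intro m n hmn
    by_contra hne
    have h := hsept m n hne
    rw [hmn, sub_self, abs_zero] at h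
    linarith
  -- the top of the column
  have hx₀a : ⟪(b₀ : EuclideanSpace ℝ (Fin 3)) + (a - 1) • u, u⟫ < a := by
    rw [inner_add_left, hbl_inner_coe_orthogonal u b₀, real_inner_smul_left,
      real_inner_self_eq_norm_sq, hu]
    linarith
  exact hbl_thickColumn_rigidity' hδ hsep hsep' hbal hbal' hu ht0 hst hsu htu hωt hωs hω't hω's hagree
    hgen hx₀a htn hinj hns hcol

/-- **Commensurate layered pairs are rigid (generic layer lattice)** (registered `∀`-form of
`hbl_layered_eq_of_finite_registries'`). [folklore] -/
theorem hbl_layered_eq_of_finite_registries : ∀ (ω ω' : Set (EuclideanSpace ℝ (Fin 3))) (δ r : ℝ), 0 < δ → 0 < r → (∀ x ∈ ω, ∀ y ∈ ω, x ≠ y → δ ≤ dist x y) → (∀ x ∈ ω', ∀ y ∈ ω', x ≠ y → δ ≤ dist x y) → (∀ c : EuclideanSpace ℝ (Fin 3), ∃ y ∈ ω, dist y c ≤ r) → (∀ x ∈ ω, HasSum (fun y : {y : EuclideanSpace ℝ (Fin 3) // y ∈ ω ∧ y ≠ x} => (deriv Literature.MathematicalPhysics.StatisticalMechanics.lennardJones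 (dist x y) / dist x y) • (x - (y : EuclideanSpace ℝ (Fin 3)))) 0) → (∀ x ∈ ω', HasSum (fun y : {y : EuclideanSpace ℝ (Fin 3) // y ∈ ω' ∧ y ≠ x} => (deriv Literature.MathematicalPhysics.StatisticalMechanics.lennardJones (dist x y) / dist x y) • (x - (y : EuclideanSpace ℝ (Fin 3)))) 0) → ∀ (s t u : EuclideanSpace ℝ (Fin 3)) (a : ℝ), ‖u‖ = 1 → t ≠ 0 → s ∉ Submodule.span ℝ ({t} : Set (EuclideanSpace ℝ (Fin 3))) → inner ℝ s u = 0 → inner ℝ t u = 0 → (∀ x : EuclideanSpace ℝ (Fin 3), x + t ∈ ω ↔ x ∈ ω) → (∀ x : EuclideanSpace ℝ (Fin 3), x + s ∈ ω ↔ x ∈ ω) → (∀ x : EuclideanSpace ℝ (Fin 3), x + t ∈ ω' ↔ x ∈ ω') → (∀ x : EuclideanSpace ℝ (Fin 3), x + s ∈ ω' ↔ x ∈ ω') → (∀ z : EuclideanSpace ℝ (Fin 3), inner ℝ z u < a → (z ∈ ω ↔ z ∈ ω')) → (∀ w w' : EuclideanSpace ℝ (Fin 3), inner ℝ w u = 0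 → inner ℝ w' u = 0 → (∃ m : ℤ, inner ℝ w s = m) → (∃ m : ℤ, inner ℝ w t = m) → (∃ m : ℤ, inner ℝ w' s = m) → (∃ m : ℤ, inner ℝ w' t = m) → ‖w'‖ = ‖w‖ → w' = w ∨ w' = -w) → ∀ (S : Finset (EuclideanSpace ℝ (Fin 3))), (∀ x ∈ ω, ∃ b ∈ S, ∃ m₁ m₂ : ℤ, ∃ τ : ℝ, x = b + (m₁ : ℝ) • s + (m₂ : ℝ) • t + τ • u) → ω = ω' := by
  intro ω ω' δ r hδ hr hsep hsep' hdense hbal hbal' s t u a hu ht0 hst hsu htu hωt hωs hω't hω's hagree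
    hgen S hS
  exact hbl_layered_eq_of_finite_registries' hδ hr hsep hsep' hdense hbal hbal' hu ht0 hst hsu htu hωt
    hωs hω't hω's hagree hgen S hS

end Summit.AtomisticToContinuum.Crystallization.Theorems.HolmgrenBoyleLind

end
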